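import Mathlib
import HarnessLib
import Literature.MathematicalPhysics.QuantumLattice.KohnLuttinger
import Literature.MathematicalPhysics.QuantumLattice.KohnLuttingerChannelStates
import Literature.MathematicalPhysics.QuantumLattice.KohnLuttingerLindhardMeasurable
import Summits.HubbardSuperconductivity.HubbardSuperconductivity.Theorems.WeakCouplingBCSWcbcsKohnLuttingerB1gReduction
import Summits.HubbardSuperconductivity.HubbardSuperconductivity.Theorems.WeakCouplingBCSKlCertTPrimePHReflection
import Summits.HubbardSuperconductivity.HubbardSuperconductivity.Theorems.WeakCouplingBCSKlSublatticeFermiMeasure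
import Summits.HubbardSuperconductivity.HubbardSuperconductivity.Theorems.WeakCouplingBCSWcbcsKohnLuttingerB1gKlCertForm
import Summits.HubbardSuperconductivity.HubbardSuperconductivity.Theorems.ChiralWindowCwChannelInfContinuousL2
import Summits.HubbardSuperconductivity.HubbardSuperconductivity.Theorems.WeakCouplingBCSKlSublatticeChannelTwist

/-!
# Sublattice duality, pull-back half: S0 and K1 of «sublattice-duality» («(KLSCAN)-SUBLATTICE-DUALITY-DISCHARGE» part 6;
# cell gate-hubbard-kl, seat p4 g20)

For `ε' = squareDispersion 0 1` (pure `t'`), `ε = squareDispersion 1 0` (pure `t`), the folded sublattice cover `Φ = fold ∘ A`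
(`klslCover`) and the twist `τ` (`klslTau`, `B1g ↔ B2g`):

* §11 at negative levels `F[ε', μ] ⊆ klslGood` (on the exceptional lines `ε' = 4cos² k₀ ≥ 0`); `σ' = σ[ε', μ]` is finite on
  `μ ∈ (-4, 0)` (its mass is that of `σ = σ[ε, μ]`, transported by `Φ`); `Φ k = A k + 2πℤ²`, `χ₀[ε](Φk + Φk') = χ₀[ε'](k + k')`,
  `Γ[ε](Φk, Φk') = Γ[ε'](k, k')`; **`klsl_kernelHS_nnn`**: the Lindhard kernel of `ε'` is Hilbert–Schmidt on `σ' ⊗ σ'`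
  (the landed `stub_klKernelHS` transported along `Φ × Φ`);
* §12 **support S0** `klsl_bddBelow_nnn` / `klsl_sublatticeFormBddBelow`: every `ε'` value set is bounded below
  (`⟨ψ, Γ'ψ⟩ = U(∫ψ)² + U² Q'(ψ)`, Cauchy–Schwarz and Hilbert–Schmidt);
* §13 **crux K1** `klsl_channelInf_sublattice_le` / `klsl_channelInfSublatticeLe`:
  `channelInf ε' μ U (τχ) ≤ channelInf ε μ U χ` for `μ ∈ (-4, 0)`, all `U`, all `χ` — every `χ`-state of `ε` pulls back along
  `Φ` to a `τχ`-state of `ε'` with the SAME pairing form (`klsl_isChannelState_cover`: kernel `Γ(Φk, Φk')`, measure `Φ_*σ' = σ`),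
  the `ε`-set is non-empty (`nonempty_isChannelState`) and the `ε'`-set is bounded below (S0).

Honest framing: exact identities/inequalities between two free-band channel problems (hubbard-klscan-idea-3's S0 and K1, whose
`tauIrrep` is `klslTau` by `cases χ <;> rfl`); nothing asserts a margin at any `t'/t ∈ [-0.3, 0)`, the window, `K₃` or
superconductivity; a Kohn–Luttinger `O(U²)` channel statement is not ODLRO.
-/

noncomputable section

set_option linter.dupNamespace false

namespace Summit.HubbardSuperconductivity.HubbardSuperconductivity.Theorems

open MeasureTheory Real Set Literature.MathematicalPhysics.QuantumLattice
open scoped ENNReal Pointwise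

/-! ### §11 The Fermi curve of `ε'` at negative levels lies in the good set; finiteness; the kernel along the cover -/

/-- On the four exceptional lines the pure `t'` band is non-negative: `k₀ ± k₁ ≡ ±π ⇒ ε'(k) = 4 cos² k₀ ≥ 0`. [folklore] -/
theorem klsl_squareDispersion_nnn_nonneg_of_not_good {k : Momentum} (hk : k ∉ klslGood) :
    0 ≤ squareDispersion 0 1 k := by
  simp only [klslGood, mem_setOf_eq, not_and_or, not_not] at hk
  have hcos : cos (k 1) = -cos (k 0) := by
    rcases hk with h | h
    · rcases abs_eq (pi_pos.le) |>.1 h with h' | h'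
      · rw [show k 1 = π - k 0 by linarith, cos_pi_sub]
      · rw [show k 1 = -(k 0 + π) by linarith, cos_neg, cos_add_pi]
    · rcases abs_eq (pi_pos.le) |>.1 h with h' | h'
      · rw [show k 1 = k 0 - π by linarith, cos_sub_pi]
      · rw [show k 1 = k 0 + π by linarith, cos_add_pi]
  simp only [squareDispersion, hcos]
  nlinarith [sq_nonneg (cos (k 0))]

/-- **At a negative level the Fermi curve of `ε'` lies inside the good set.** [folklore] -/
theorem klsl_fermiCurve_nnn_subset_good {μ : ℝ} (hμ : μ < 0) : fermiCurve (squareDispersion 0 1) μ ⊆ klslGood := by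
  intro k hk
  by_contra h
  have h0 := klsl_squareDispersion_nnn_nonneg_of_not_good h
  rw [hk.2] at h0
  linarith

/-- … hence the good set has full Fermi-curve measure: `σ'(Gᶜ) = 0`. [folklore] -/
theorem klsl_ae_mem_good {μ : ℝ} (hμ : μ < 0) : ∀ᵐ k ∂fermiCurveMeasure (squareDispersion 0 1) μ, k ∈ klslGood := by
  rw [ae_iff]
  refine klph_fermiCurveMeasure_null_of_countable_or_gradient (measurable_squareDispersion 0 1) μ
    klsl_measurableSet_good.compl (Or.inl ?_)
  have h : {k | ¬ k ∈ klslGood} ∩ fermiCurve (squareDispersion 0 1) μ = ∅ :=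
    Set.eq_empty_iff_forall_notMem.2 fun k hk => hk.1 (klsl_fermiCurve_nnn_subset_good hμ hk.2)
  rw [h]
  exact countable_empty

/-- **The Fermi-curve measure of `ε'` is finite on `(-4, 0)`** (its total mass is that of `σ`, by the cover). [folklore] -/
theorem klsl_isFiniteMeasure_nnn {μ : ℝ} (hμ : μ ∈ Ioo (-4 : ℝ) 0) :
    IsFiniteMeasure (fermiCurveMeasure (squareDispersion 0 1) μ) := by
  haveI := stub_klFiniteMeasure stub_klGradient stub_klHausdorffFinite μ hμ
  refine ⟨?_⟩
  have h : fermiCurveMeasure (squareDispersion 0 1) μ univ = fermiCurveMeasure (squareDispersion 1 0) μ univ := by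
    rw [← klsl_map_cover_fermiCurveMeasure μ, Measure.map_apply measurable_klslCover MeasurableSet.univ, preimage_univ]
  rw [h]
  exact measure_lt_top _ _

/-- The fold shifts by a lattice vector: `fold x = x + m · 2π` with `m ∈ {-1, 0, 1}`. [folklore] -/
theorem klslWrap_eq_add_int (x : ℝ) : ∃ m : ℤ, klslWrap x = x + m * (2 * π) := by
  unfold klslWrap
  split_ifs
  · exact ⟨1, by simp⟩
  · exact ⟨0, by simp⟩
  · exact ⟨-1, by simp; ring⟩

/-- **The cover differs from `A` by a lattice vector**: `Φ k = A k + c(k)`, `c(k) ∈ 2πℤ²`. [folklore] -/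
theorem klslCover_eq_klslA_add (k : Momentum) :
    ∃ a b : ℝ, (∃ m : ℤ, a = m * (2 * π)) ∧ (∃ n : ℤ, b = n * (2 * π)) ∧ klslCover k = klslA k + klslVec a b := by
  obtain ⟨m, hm⟩ := klslWrap_eq_add_int (k 0 + k 1)
  obtain ⟨n, hn⟩ := klslWrap_eq_add_int (k 0 - k 1)
  refine ⟨m * (2 * π), n * (2 * π), ⟨m, rfl⟩, ⟨n, rfl⟩, ?_⟩
  ext i; fin_cases i
  · simp [klslCover, hm]
  · simp [klslCover, hn]

/-- The Lindhard function of the pure `t` band is `2πℤ²`-periodic in the transfer. [folklore] -/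
theorem klsl_lindhardFunction_nn_add_vec (μ : ℝ) (q : Momentum) {a b : ℝ} (ha : ∃ m : ℤ, a = m * (2 * π))
    (hb : ∃ n : ℤ, b = n * (2 * π)) :
    lindhardFunction (squareDispersion 1 0) μ (q + klslVec a b) = lindhardFunction (squareDispersion 1 0) μ q := by
  obtain ⟨m, rfl⟩ := ha
  obtain ⟨n, rfl⟩ := hb
  refine klph_lindhardFunction_congr μ fun p => ?_
  simp only [squareDispersion, PiLp.add_apply, klslVec_apply_zero, klslVec_apply_one, ← add_assoc,
    Real.cos_add_int_mul_two_pi]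

/-- **`χ₀` along the cover**: `χ₀[ε](Φ k + Φ k') = χ₀[ε'](k + k')` for all `k, k'` (S1 + periodicity). [folklore] -/
theorem klsl_lindhardFunction_cover_add (μ : ℝ) (k k' : Momentum) :
    lindhardFunction (squareDispersion 1 0) μ (klslCover k + klslCover k') =
      lindhardFunction (squareDispersion 0 1) μ (k + k') := by
  obtain ⟨a, b, ha, hb, hk⟩ := klslCover_eq_klslA_add k
  obtain ⟨a', b', ha', hb', hk'⟩ := klslCover_eq_klslA_add k'
  obtain ⟨m, rfl⟩ := ha; obtain ⟨n, rfl⟩ := hb; obtain ⟨m', rfl⟩ := ha'; obtain ⟨n', rfl⟩ := hb'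
  rw [klsl_lindhardFunction_sublattice, klslA_add, hk, hk']
  have hsum : klslA k + klslVec (m * (2 * π)) (n * (2 * π)) + (klslA k' + klslVec (m' * (2 * π)) (n' * (2 * π))) =
      (klslA k + klslA k') + klslVec (((m + m' : ℤ) : ℝ) * (2 * π)) (((n + n' : ℤ) : ℝ) * (2 * π)) := by
    ext i; fin_cases i <;> simp [Int.cast_add] <;> ring
  rw [hsum, klsl_lindhardFunction_nn_add_vec μ _ ⟨m + m', rfl⟩ ⟨n + n', rfl⟩]

/-- **The kernel along the cover**: `Γ[ε](Φ k, Φ k') = Γ[ε'](k, k')` for all `k, k'`. [folklore] -/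
theorem klsl_kohnLuttingerKernel_cover (μ U : ℝ) (k k' : Momentum) :
    kohnLuttingerKernel (squareDispersion 1 0) μ U (klslCover k) (klslCover k') =
      kohnLuttingerKernel (squareDispersion 0 1) μ U k k' := by
  rw [kohnLuttingerKernel, kohnLuttingerKernel, klsl_lindhardFunction_cover_add]

/-- **The Lindhard kernel of `ε'` is Hilbert–Schmidt on `σ' ⊗ σ'`** for `μ ∈ (-4, 0)`: transport of the landed
`stub_klKernelHS` along `Φ × Φ`. [folklore] -/
theorem klsl_kernelHS_nnn {μ : ℝ} (hμ : μ ∈ Ioo (-4 : ℝ) 0) :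
    MemLp (fun z : Momentum × Momentum => lindhardFunction (squareDispersion 0 1) μ (z.1 + z.2)) 2
      ((fermiCurveMeasure (squareDispersion 0 1) μ).prod (fermiCurveMeasure (squareDispersion 0 1) μ)) := by
  haveI := klsl_isFiniteMeasure_nnn hμ
  haveI := stub_klFiniteMeasure stub_klGradient stub_klHausdorffFinite μ hμ
  have hK := stub_klKernelHS μ hμ
  have hmp := (klsl_measurePreserving_cover_fermi μ).prod (klsl_measurePreserving_cover_fermi μ)
  have h := hK.comp_measurePreserving hmp
  have heq : ((fun z : Momentum × Momentum => lindhardFunction (squareDispersion 1 0) μ (z.1 + z.2)) ∘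
      Prod.map klslCover klslCover) = fun z => lindhardFunction (squareDispersion 0 1) μ (z.1 + z.2) := by
    funext z
    simp only [Function.comp_apply, Prod.map_fst, Prod.map_snd, klsl_lindhardFunction_cover_add]
  rwa [heq] at h

/-! ### §12 Support S0: the value set of the `t'` band is bounded below -/

/-- **Support S0 `SublatticeFormBddBelow`**: for `μ ∈ (-4, 0)`, every `U` and every channel, the pairing form of
`ε' = squareDispersion 0 1` is bounded below on the channel states (`⟨ψ, Γ'ψ⟩ = U (∫ψ)² + U² Q'(ψ)` with
`(∫ψ)² ≤ σ'(ℝ²)` by Cauchy–Schwarz and `|Q'(ψ)| ≤ ‖χ₀'‖_{HS}` by Hilbert–Schmidt), so `channelInf ε' …` is a genuine infimum.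
[cite: RaghuKivelsonScalapino2010, §II (7) and (13)] -/
theorem klsl_bddBelow_nnn {μ : ℝ} (hμ : μ ∈ Ioo (-4 : ℝ) 0) (U : ℝ) (χ : D4Irrep) :
    BddBelow ((pairingForm (squareDispersion 0 1) μ U) '' {ψ | IsChannelState (squareDispersion 0 1) μ χ ψ}) := by
  haveI := klsl_isFiniteMeasure_nnn hμ
  have hK := klsl_kernelHS_nnn hμ
  refine ⟨-(|U| * (fermiCurveMeasure (squareDispersion 0 1) μ).real univ) -
    U ^ 2 * Real.sqrt (∫ z, (lindhardFunction (squareDispersion 0 1) μ (z.1 + z.2)) ^ 2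
      ∂(fermiCurveMeasure (squareDispersion 0 1) μ).prod (fermiCurveMeasure (squareDispersion 0 1) μ)), ?_⟩
  rintro x ⟨ψ, hψ, rfl⟩
  have hsplit := klhs_frame_pairingForm_split U hK hψ.1
  have hQ := abs_integral_mul_integral_mul_le (M := fun z : Momentum × Momentum =>
    lindhardFunction (squareDispersion 0 1) μ (z.1 + z.2)) hψ.1 hK
  rw [hψ.2.1, one_mul] at hQ
  have hone : MemLp (fun _ : Momentum => (1 : ℝ)) 2 (fermiCurveMeasure (squareDispersion 0 1) μ) := memLp_const 1
  have hcs := abs_integral_mul_le_sqrt_mul_sqrt hone hψ.1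
  simp only [one_mul, one_pow, integral_const, smul_eq_mul, mul_one] at hcs
  rw [hψ.2.1, Real.sqrt_one, mul_one] at hcs
  have hM0 : 0 ≤ (fermiCurveMeasure (squareDispersion 0 1) μ).real univ := measureReal_nonneg
  have hsq : (∫ k, ψ k ∂fermiCurveMeasure (squareDispersion 0 1) μ) ^ 2 ≤
      (fermiCurveMeasure (squareDispersion 0 1) μ).real univ := by
    have h1 := pow_le_pow_left₀ (abs_nonneg _) hcs 2
    rwa [sq_abs, Real.sq_sqrt hM0] at h1
  rw [hsplit]
  have hQ' := neg_abs_le (∫ k, ψ k * ∫ k', lindhardFunction (squareDispersion 0 1) μ (k + k') * ψ k'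
    ∂fermiCurveMeasure (squareDispersion 0 1) μ ∂fermiCurveMeasure (squareDispersion 0 1) μ)
  have hU : -(|U| * (fermiCurveMeasure (squareDispersion 0 1) μ).real univ) ≤
      U * (∫ k, ψ k ∂fermiCurveMeasure (squareDispersion 0 1) μ) ^ 2 := by
    have h2 : -|U| ≤ U := neg_abs_le U
    have h3 : U ≤ |U| := le_abs_self U
    nlinarith [sq_nonneg (∫ k, ψ k ∂fermiCurveMeasure (squareDispersion 0 1) μ), abs_nonneg U]
  nlinarith [sq_nonneg U]

/-! ### §13 Crux K1: channel states of `ε` pull back along the cover -/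

/-- The pairing form only sees the `σ`-a.e. class of the gap function. [folklore] -/
theorem klsl_pairingForm_congr_ae {ε : Momentum → ℝ} {μ : ℝ} (U : ℝ) {f g : Momentum → ℝ}
    (h : f =ᵐ[fermiCurveMeasure ε μ] g) : pairingForm ε μ U f = pairingForm ε μ U g := by
  unfold pairingForm
  have hin : ∀ k, ∫ k', kohnLuttingerKernel ε μ U k k' * f k' ∂fermiCurveMeasure ε μ =
      ∫ k', kohnLuttingerKernel ε μ U k k' * g k' ∂fermiCurveMeasure ε μ :=
    fun k => integral_congr_ae (h.mono fun k' hk' => by simp only [hk'])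
  exact integral_congr_ae (h.mono fun k hk => by simp only [hk, hin k])

/-- **The pairing form transports along the cover**: for `ψ ∈ L²(σ[ε, μ])`, `μ ∈ (-4, 0)`,
`⟨ψ ∘ Φ, Γ' (ψ ∘ Φ)⟩_{σ'} = ⟨ψ, Γ ψ⟩_{σ}` at every coupling (kernel `Γ'(k, k') = Γ(Φk, Φk')`, measure `Φ_* σ' = σ`; the inner
integral is transported pointwise in `k`, the outer one by `integral_map` with the parametric integral a.e.-strongly measurable).
[cite: RaghuKivelsonScalapino2010, §II (7)] -/
theorem klsl_pairingForm_comp_cover {μ : ℝ} (hμ : μ ∈ Ioo (-4 : ℝ) 0) {ψ : Momentum → ℝ}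
    (hmem : MemLp ψ 2 (fermiCurveMeasure (squareDispersion 1 0) μ)) (U : ℝ) :
    pairingForm (squareDispersion 0 1) μ U (ψ ∘ klslCover) = pairingForm (squareDispersion 1 0) μ U ψ := by
  haveI := stub_klFiniteMeasure stub_klGradient stub_klHausdorffFinite μ hμ
  have hKm := measurable_kohnLuttingerKernel_uncurry (measurable_squareDispersion 1 0) μ U
  have hinner : ∀ k,
      ∫ k', kohnLuttingerKernel (squareDispersion 0 1) μ U k k' * ψ (klslCover k')
          ∂fermiCurveMeasure (squareDispersion 0 1) μ =
        ∫ u, kohnLuttingerKernel (squareDispersion 1 0) μ U (klslCover k) u * ψ u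
          ∂fermiCurveMeasure (squareDispersion 1 0) μ := by
    intro k
    have hfm : AEStronglyMeasurable (fun u => kohnLuttingerKernel (squareDispersion 1 0) μ U (klslCover k) u * ψ u)
        (fermiCurveMeasure (squareDispersion 1 0) μ) :=
      (measurable_kohnLuttingerKernel_right (measurable_squareDispersion 1 0) μ U (klslCover k)).aestronglyMeasurable.mul
        hmem.1
    have h1 : ∫ k', kohnLuttingerKernel (squareDispersion 0 1) μ U k k' * ψ (klslCover k')
          ∂fermiCurveMeasure (squareDispersion 0 1) μ =
        ∫ k', (fun u => kohnLuttingerKernel (squareDispersion 1 0) μ U (klslCover k) u * ψ u) (klslCover k')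
          ∂fermiCurveMeasure (squareDispersion 0 1) μ := by
      refine integral_congr_ae (Filter.Eventually.of_forall fun k' => ?_)
      simp only [klsl_kohnLuttingerKernel_cover]
    rw [h1, klsl_integral_comp_cover μ hfm]
  have hI : AEStronglyMeasurable
      (fun u => ∫ u', kohnLuttingerKernel (squareDispersion 1 0) μ U u u' * ψ u' ∂fermiCurveMeasure (squareDispersion 1 0) μ)
      (fermiCurveMeasure (squareDispersion 1 0) μ) := by
    have h2 : AEStronglyMeasurable
        (fun z : Momentum × Momentum => kohnLuttingerKernel (squareDispersion 1 0) μ U z.1 z.2 * ψ z.2)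
        ((fermiCurveMeasure (squareDispersion 1 0) μ).prod (fermiCurveMeasure (squareDispersion 1 0) μ)) :=
      hKm.aestronglyMeasurable.mul hmem.1.comp_snd
    exact h2.integral_prod_right'
  have hfm2 : AEStronglyMeasurable (fun u => ψ u *
      ∫ u', kohnLuttingerKernel (squareDispersion 1 0) μ U u u' * ψ u' ∂fermiCurveMeasure (squareDispersion 1 0) μ)
      (fermiCurveMeasure (squareDispersion 1 0) μ) := hmem.1.mul hI
  unfold pairingForm
  have h2 : ∫ k, (ψ ∘ klslCover) k *
        ∫ k', kohnLuttingerKernel (squareDispersion 0 1) μ U k k' * (ψ ∘ klslCover) k'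
          ∂fermiCurveMeasure (squareDispersion 0 1) μ ∂fermiCurveMeasure (squareDispersion 0 1) μ =
      ∫ k, (fun u => ψ u * ∫ u', kohnLuttingerKernel (squareDispersion 1 0) μ U u u' * ψ u'
          ∂fermiCurveMeasure (squareDispersion 1 0) μ) (klslCover k) ∂fermiCurveMeasure (squareDispersion 0 1) μ := by
    refine integral_congr_ae (Filter.Eventually.of_forall fun k => ?_)
    simp only [Function.comp_apply, hinner k]
  rw [h2, klsl_integral_comp_cover μ hfm2]


/-- **Transport of channel states along the cover.** If `ψ` is a normalised `L²(σ[ε, μ])` gap function in the channel `χ`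
(`ε = squareDispersion 1 0`, `μ ∈ (-4, 0)`), then `𝟙_G · (ψ ∘ Φ)` is a normalised `L²(σ[ε', μ])` gap function in the channel
`τχ` of the pure `t'` band `ε' = squareDispersion 0 1`, with the same pairing form at every coupling `U`
(kernel `Γ'(k,k') = Γ(Φk, Φk')`, measure `Φ_* σ' = σ`). [cite: RaghuKivelsonScalapino2010, §II (7) and §III (17)] -/
theorem klsl_isChannelState_cover {μ : ℝ} (hμ : μ ∈ Ioo (-4 : ℝ) 0) (χ : D4Irrep) {ψ : Momentum → ℝ}
    (hψ : IsChannelState (squareDispersion 1 0) μ χ ψ) :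
    IsChannelState (squareDispersion 0 1) μ (klslTau χ) (klslGood.indicator (ψ ∘ klslCover)) ∧
      ∀ U : ℝ, pairingForm (squareDispersion 0 1) μ U (klslGood.indicator (ψ ∘ klslCover)) =
        pairingForm (squareDispersion 1 0) μ U ψ := by
  obtain ⟨hmem, hnorm, hch⟩ := hψ
  haveI := stub_klFiniteMeasure stub_klGradient stub_klHausdorffFinite μ hμ
  haveI := klsl_isFiniteMeasure_nnn hμ
  have hae : klslGood.indicator (ψ ∘ klslCover) =ᵐ[fermiCurveMeasure (squareDispersion 0 1) μ] (ψ ∘ klslCover) := by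
    filter_upwards [klsl_ae_mem_good (μ := μ) hμ.2] with k hk
    simp only [Set.indicator_of_mem hk]
  -- (1) channel, (2) square integrability, (3) normalisation
  have hchφ : InChannel (klslTau χ) (klslGood.indicator (ψ ∘ klslCover)) := klsl_inChannel_cover hch
  have hmemφ : MemLp (klslGood.indicator (ψ ∘ klslCover)) 2 (fermiCurveMeasure (squareDispersion 0 1) μ) :=
    (klsl_memLp_comp_cover μ hmem).ae_eq hae.symm
  have hsqm : AEStronglyMeasurable (fun u => ψ u ^ 2) (fermiCurveMeasure (squareDispersion 1 0) μ) := hmem.1.pow 2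
  have hnormφ : ∫ k, klslGood.indicator (ψ ∘ klslCover) k ^ 2 ∂fermiCurveMeasure (squareDispersion 0 1) μ = 1 := by
    have h1 : ∫ k, klslGood.indicator (ψ ∘ klslCover) k ^ 2 ∂fermiCurveMeasure (squareDispersion 0 1) μ =
        ∫ k, (fun u => ψ u ^ 2) (klslCover k) ∂fermiCurveMeasure (squareDispersion 0 1) μ :=
      integral_congr_ae (hae.mono fun k hk => by simp only [hk, Function.comp_apply])
    rw [h1, klsl_integral_comp_cover μ hsqm]
    exact hnorm
  refine ⟨⟨hmemφ, hnormφ, hchφ⟩, fun U => ?_⟩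
  -- (4) the pairing form
  rw [klsl_pairingForm_congr_ae U hae, klsl_pairingForm_comp_cover hμ hmem U]

/-- The value set of the pairing form of `ε` in channel `χ` is contained in that of `ε'` in channel `τχ`. [folklore] -/
theorem klsl_pairingForm_image_subset {μ : ℝ} (hμ : μ ∈ Ioo (-4 : ℝ) 0) (U : ℝ) (χ : D4Irrep) :
    pairingForm (squareDispersion 1 0) μ U '' {ψ | IsChannelState (squareDispersion 1 0) μ χ ψ} ⊆
      pairingForm (squareDispersion 0 1) μ U '' {ψ | IsChannelState (squareDispersion 0 1) μ (klslTau χ) ψ} := by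
  rintro x ⟨ψ, hψ, rfl⟩
  obtain ⟨hst, hform⟩ := klsl_isChannelState_cover hμ χ hψ
  exact ⟨_, hst, hform U⟩

/-- **Crux K1 `ChannelInfSublatticeLe` — the pull-back half of the sublattice duality**: for `μ ∈ (-4, 0)`, every `U`
and every channel `χ`, `channelInf (squareDispersion 0 1) μ U (τχ) ≤ channelInf (squareDispersion 1 0) μ U χ`
(the `ε`-value set is non-empty, `nonempty_isChannelState`, and sits inside the `ε'`-value set, which is bounded below, S0).
[cite: RaghuKivelsonScalapino2010, §II (7) and (13)] -/
theorem klsl_channelInf_sublattice_le {μ : ℝ} (hμ : μ ∈ Ioo (-4 : ℝ) 0) (U : ℝ) (χ : D4Irrep) :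
    channelInf (squareDispersion 0 1) μ U (klslTau χ) ≤ channelInf (squareDispersion 1 0) μ U χ :=
  csInf_le_csInf (klsl_bddBelow_nnn hμ U (klslTau χ)) ((nonempty_isChannelState hμ.1 hμ.2 χ).image _)
    (klsl_pairingForm_image_subset hμ U χ)

/-- S0 in the shape of hubbard-klscan-idea-3's `KlSublattice.SublatticeFormBddBelow`. [folklore] -/
theorem klsl_sublatticeFormBddBelow :
    ∀ μ ∈ Set.Ioo (-4 : ℝ) 0, ∀ U : ℝ, ∀ χ : D4Irrep,
      BddBelow ((pairingForm (squareDispersion 0 1) μ U) '' {ψ | IsChannelState (squareDispersion 0 1) μ χ ψ}) :=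
  fun _ hμ U χ => klsl_bddBelow_nnn hμ U χ

/-- K1 in the shape of hubbard-klscan-idea-3's `KlSublattice.ChannelInfSublatticeLe` (with `klslTau` for its `tauIrrep`;
the two agree by `cases χ <;> rfl`). [folklore] -/
theorem klsl_channelInfSublatticeLe :
    ∀ μ ∈ Set.Ioo (-4 : ℝ) 0, ∀ U : ℝ, ∀ χ : D4Irrep,
      channelInf (squareDispersion 0 1) μ U (klslTau χ) ≤ channelInf (squareDispersion 1 0) μ U χ :=
  fun _ hμ U χ => klsl_channelInf_sublattice_le hμ U χ

end Summit.HubbardSuperconductivity.HubbardSuperconductivity.Theorems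

end
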